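import Mathlib
import HarnessLib
import Literature.Analysis.FluidPDE.OctahedralSymmetry
import Literature.MathematicalPhysics.QuantumLattice.EuclideanAction
import Summits.QuantumFields.YangMills.Theses.PencilRigidity
import Summits.QuantumFields.YangMills.Theorems.PencilRigidityShellRigidityExponentReduction
import Summits.QuantumFields.YangMills.Theorems.PencilRigidityShellRigidityAxisLaplace
import Summits.QuantumFields.YangMills.Theorems.PencilRigidityShellRigidityRadialLift
import Summits.QuantumFields.YangMills.Theorems.PencilRigidityShellRigidityPlanarDiscSections
import Summits.QuantumFields.YangMills.Theorems.PencilRigidityShellRigidityConeOfDiscSections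
import Summits.QuantumFields.YangMills.Theorems.PencilRigidityShellRigiditySmearTransport
import Summits.QuantumFields.YangMills.Theorems.PencilRigidityShellRigidityPlanarRadial

/-!
# Shell rigidity: sixteen mirrors are worth a continuum of rotations below the `|x|⁻¹⁰` threshold
# (crux `PencilRigidity.ShellRigidity`, stmt-QuantumFields-11685, route-QuantumFields-PencilRigidity)

**Theorem** (`ShellRigidity_proof`, the route decl BY NAME). Let `K : ℝ⁴ → ℝ` be continuous off the
origin, with `|K x| ≤ C (1 + ‖x‖^(η-10))` off `0` for some `η > 0`, invariant under every signed
permutation of the coordinates (the hyperoctahedral group `W(B₄)`), and pointwise Osterwalder–Schrader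
positive across the axis mirror `x₀ = 0` and across the diagonal mirror `x₀ = x₁`. Then `K (R x) = K x`
for every linear isometry `R` of `ℝ⁴` and every `x ≠ 0`.

**Proof** (line `transverse-smearing-planar-threshold` of the crux chain; the lead's closing file,
assembling the landed stub files):
1. `stub_exponentReduction` — WLOG `η ≤ 7` (for `η > 10` the kernel is bounded off the unit ball by
   log-convexity of `t ↦ K(t e₀)` + Gram domination + `W(B₄)`).
2. `stub_axisLaplace` — kernel-level OS reconstruction along the time axis: for every `ε > 0`,
   `K((ε+t)e₀ + a) = ∫ e^{-t p₀ + i⟨a,p⟩} dμ_ε` with a finite positive measure on `{p₀ ≥ 0}`; applied to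
   `K` and to `K ∘ L₄`, `L₄ (x₀,x₁,x₂,x₃) = ((x₀+x₁)/√2, (x₀-x₁)/√2, x₂, x₃)` — the diagonal clause of the
   crux is the axis clause of `K ∘ L₄` and `W(B₄)` conjugates the needed symmetries (`kernel45_*` below).
3. `stub_smearTransport` — the transverse plane `(x₂,x₃)` lies in all four mirrors, so every
   autocorrelation smearing `F_h(t,s) = ∫∫ h(y)h(y')K(t,s,y-y') dy dy'`, `h ∈ C_c(ℝ²)`, is a continuous
   `D₄`-symmetric planar kernel of order `8 - η < 8` (one notch below the planar threshold `8`) with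
   Laplace–Fourier representations in the axis and (through `smear_lc4`) the diagonal chart.
4. `stub_planarRadial` — the planar engine: the two diagonal representations are the two slots of the
   tree's sector engine (Osterwalder–Schrader's (5.8)), whose Thales slice gives disc sections
   (`stub_planarDiscSections`); Landau–Pringsheim puts every spectral measure on the light cone
   (`stub_coneOfDiscSections`, speed of light exactly `1` from the `45°` mirrors); the complexified polar
   angle then carries charts of exponential type `≤ 8 - η < 8`, so only the Fourier modes `e^{4inα}`,
   `|n| ≤ 1`, of `α ↦ F_h(r cos α, r sin α)` survive, and positivity at imaginary angles in the axis and
   the diagonal chart kills `n = ±1` (`stub_planarAngularRigidity` = `stub_angularChart` +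
   `stub_fourierVanish`): every `F_h` is radial.
5. `stub_radialLift` — polarisation of the quadratic form `h ↦ F_h` and a norm reduction through the
   coordinate permutations give `K (R x) = K x` for every linear isometry `R`.

Sharpness and load-bearing hypotheses are recorded on the negative side
(`Theorems/ShellRigidity/Negative/PlanarThresholdSharp.lean`: `cos 8φ / r⁸` at order exactly `8`;
`Negative/LoadBearing.lean`: `W(B₄)` and the diagonal mirror cannot be dropped).

References: K. Osterwalder, R. Schrader, Comm. Math. Phys. 31 (1973) §4 and 42 (1975) Ch. V;
C. Berg, J. P. R. Christensen, P. Ressel, *Harmonic Analysis on Semigroups* (1984) §4.4;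
E. Lukacs, *Characteristic Functions* (1970) Thm. 7.1.1; J. Fröhlich, R. Israel, E. Lieb, B. Simon,
Comm. Math. Phys. 62 (1978) §3 (diagonal reflection positivity).
-/

noncomputable section

namespace Summit.QuantumFields.YangMills.Cruxes.ShellRigidity.TransverseSmearingPlanarThreshold

open MeasureTheory Complex
open scoped BigOperators InnerProductSpace
open Literature.MathematicalPhysics.QuantumLattice Literature.Analysis.FluidPDE

/-! ## Glue I — the kernel's symmetries from `W(B₄)` (tree toolkit `IsSignedPermIsometry`) -/

section KernelSymm

variable {K : EuclideanSpace ℝ (Fin 4) → ℝ}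
  (hW : ∀ R : EuclideanSpace ℝ (Fin 4) ≃ₗᵢ[ℝ] EuclideanSpace ℝ (Fin 4), IsSignedPermIsometry R →
    ∀ x : EuclideanSpace ℝ (Fin 4), K (R x) = K x)
include hW

/-- Sign flips are in `W(B₄)`. -/
theorem K_mirror (k : Fin 4) (x : EuclideanSpace ℝ (Fin 4)) : K (mirrorReflection k x) = K x :=
  hW _ (isSignedPermIsometry_mirrorReflection k) x

/-- Transpositions are in `W(B₄)`. -/
theorem K_swapR (k l : Fin 4) (x : EuclideanSpace ℝ (Fin 4)) : K (swapReflection k l x) = K x :=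
  hW _ (isSignedPermIsometry_swapReflection k l) x

/-- Time reflection invariance, coordinate form. -/
theorem K_theta (x y : EuclideanSpace ℝ (Fin 4)) (h0 : y 0 = -x 0) (h1 : y 1 = x 1) (h2 : y 2 = x 2)
    (h3 : y 3 = x 3) : K y = K x := by
  have : y = mirrorReflection 0 x := by
    ext i; fin_cases i <;> simp [mirrorReflection_apply, h0, h1, h2, h3]
  rw [this, K_mirror hW]

/-- Spatial parity invariance, coordinate form. -/
theorem K_parity (x y : EuclideanSpace ℝ (Fin 4)) (h0 : y 0 = x 0) (h1 : y 1 = -x 1) (h2 : y 2 = -x 2)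
    (h3 : y 3 = -x 3) : K y = K x := by
  have : y = mirrorReflection 1 (mirrorReflection 2 (mirrorReflection 3 x)) := by
    ext i; fin_cases i <;> simp [mirrorReflection_apply, h0, h1, h2, h3]
  rw [this, K_mirror hW, K_mirror hW, K_mirror hW]

/-- Swap invariance, coordinate form. -/
theorem K_swap (x y : EuclideanSpace ℝ (Fin 4)) (h0 : y 0 = x 1) (h1 : y 1 = x 0) (h2 : y 2 = x 2)
    (h3 : y 3 = x 3) : K y = K x := by
  have : y = swapReflection 0 1 x := by
    ext i; fin_cases i <;> simp [swapReflection_apply, h0, h1, h2, h3, Equiv.swap_apply_def]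
  rw [this, K_swapR hW]

/-- `x₁ ↦ -x₁` invariance, coordinate form. -/
theorem K_neg1 (x y : EuclideanSpace ℝ (Fin 4)) (h0 : y 0 = x 0) (h1 : y 1 = -x 1) (h2 : y 2 = x 2)
    (h3 : y 3 = x 3) : K y = K x := by
  have : y = mirrorReflection 1 x := by
    ext i; fin_cases i <;> simp [mirrorReflection_apply, h0, h1, h2, h3]
  rw [this, K_mirror hW]

end KernelSymm

/-! ## Glue II — the light-cone involution `L₄` of `ℝ⁴` (written out) and the diagonal frame -/

/-- `((a + b)/√2)² + ((a - b)/√2)² = a² + b²`. -/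
theorem sq_div_sqrt_two_add (a b : ℝ) :
    ((a + b) / Real.sqrt 2) ^ 2 + ((a - b) / Real.sqrt 2) ^ 2 = a ^ 2 + b ^ 2 := by
  rw [div_pow, div_pow, Real.sq_sqrt two_pos.le]; ring

/-- `L₄` preserves the norm. -/
theorem norm_lc4 (x : EuclideanSpace ℝ (Fin 4)) :
    ‖(WithLp.toLp 2 ![(x 0 + x 1) / Real.sqrt 2, (x 0 - x 1) / Real.sqrt 2, x 2, x 3] :
        EuclideanSpace ℝ (Fin 4))‖ = ‖x‖ := by
  rw [EuclideanSpace.norm_eq, EuclideanSpace.norm_eq]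
  congr 1
  simp only [Fin.sum_univ_four, Real.norm_eq_abs, sq_abs]
  simp only [Fin.isValue, Matrix.cons_val_zero, Matrix.cons_val_one, Matrix.cons_val]
  linarith [sq_div_sqrt_two_add (x 0) (x 1)]

/-- `L₄ x ≠ 0` for `x ≠ 0`. -/
theorem lc4_ne_zero {x : EuclideanSpace ℝ (Fin 4)} (hx : x ≠ 0) :
    (WithLp.toLp 2 ![(x 0 + x 1) / Real.sqrt 2, (x 0 - x 1) / Real.sqrt 2, x 2, x 3] :
        EuclideanSpace ℝ (Fin 4)) ≠ 0 := by
  intro h0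
  apply hx
  have h1 : ‖x‖ = 0 := by rw [← norm_lc4 x, h0, norm_zero]
  exact norm_eq_zero.1 h1

/-- `L₄` is continuous. -/
theorem continuous_lc4 : Continuous fun x : EuclideanSpace ℝ (Fin 4) =>
    (WithLp.toLp 2 ![(x 0 + x 1) / Real.sqrt 2, (x 0 - x 1) / Real.sqrt 2, x 2, x 3] :
      EuclideanSpace ℝ (Fin 4)) := by
  refine (PiLp.continuous_toLp 2 _).comp (continuous_pi fun i => ?_)
  fin_cases i <;> simp <;> fun_prop

section Kernel45

variable {K : EuclideanSpace ℝ (Fin 4) → ℝ}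

/-- `K ∘ L₄` is continuous off `0`. -/
theorem kernel45_continuousOn (hc : ContinuousOn K {x | x ≠ 0}) :
    ContinuousOn (fun x : EuclideanSpace ℝ (Fin 4) =>
      K (WithLp.toLp 2 ![(x 0 + x 1) / Real.sqrt 2, (x 0 - x 1) / Real.sqrt 2, x 2, x 3]))
      {x : EuclideanSpace ℝ (Fin 4) | x ≠ 0} :=
  hc.comp continuous_lc4.continuousOn fun _ hx => lc4_ne_zero hx

/-- `K ∘ L₄` obeys the same bound. -/
theorem kernel45_bound {C q : ℝ}
    (hb : ∀ x : EuclideanSpace ℝ (Fin 4), x ≠ 0 → |K x| ≤ C * (1 + ‖x‖ ^ q)) :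
    ∀ x : EuclideanSpace ℝ (Fin 4), x ≠ 0 →
      |K (WithLp.toLp 2 ![(x 0 + x 1) / Real.sqrt 2, (x 0 - x 1) / Real.sqrt 2, x 2, x 3])| ≤
        C * (1 + ‖x‖ ^ q) := fun x hx => by
  simpa only [norm_lc4] using hb _ (lc4_ne_zero hx)

variable (hW : ∀ R : EuclideanSpace ℝ (Fin 4) ≃ₗᵢ[ℝ] EuclideanSpace ℝ (Fin 4), IsSignedPermIsometry R →
    ∀ x : EuclideanSpace ℝ (Fin 4), K (R x) = K x)
include hW

/-- Time reflection in the diagonal frame is `(x₀,x₁) ↦ (-x₁,-x₀)` upstairs. -/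
theorem kernel45_theta (x y : EuclideanSpace ℝ (Fin 4)) (h0 : y 0 = -x 0) (h1 : y 1 = x 1)
    (h2 : y 2 = x 2) (h3 : y 3 = x 3) :
    K (WithLp.toLp 2 ![(y 0 + y 1) / Real.sqrt 2, (y 0 - y 1) / Real.sqrt 2, y 2, y 3]) =
      K (WithLp.toLp 2 ![(x 0 + x 1) / Real.sqrt 2, (x 0 - x 1) / Real.sqrt 2, x 2, x 3]) := by
  have : (WithLp.toLp 2 ![(y 0 + y 1) / Real.sqrt 2, (y 0 - y 1) / Real.sqrt 2, y 2, y 3] :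
      EuclideanSpace ℝ (Fin 4)) = swapReflection 0 1 (mirrorReflection 0 (mirrorReflection 1
        (WithLp.toLp 2 ![(x 0 + x 1) / Real.sqrt 2, (x 0 - x 1) / Real.sqrt 2, x 2, x 3]))) := by
    ext i
    fin_cases i <;>
      (simp [swapReflection_apply, mirrorReflection_apply, Equiv.swap_apply_def, h0, h1, h2, h3]; try ring)
  rw [this, K_swapR hW, K_mirror hW, K_mirror hW]

/-- Spatial parity in the diagonal frame is `(x₀,x₁,x₂,x₃) ↦ (x₁,x₀,-x₂,-x₃)` upstairs. -/
theorem kernel45_parity (x y : EuclideanSpace ℝ (Fin 4)) (h0 : y 0 = x 0) (h1 : y 1 = -x 1)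
    (h2 : y 2 = -x 2) (h3 : y 3 = -x 3) :
    K (WithLp.toLp 2 ![(y 0 + y 1) / Real.sqrt 2, (y 0 - y 1) / Real.sqrt 2, y 2, y 3]) =
      K (WithLp.toLp 2 ![(x 0 + x 1) / Real.sqrt 2, (x 0 - x 1) / Real.sqrt 2, x 2, x 3]) := by
  have : (WithLp.toLp 2 ![(y 0 + y 1) / Real.sqrt 2, (y 0 - y 1) / Real.sqrt 2, y 2, y 3] :
      EuclideanSpace ℝ (Fin 4)) = swapReflection 0 1 (mirrorReflection 2 (mirrorReflection 3
        (WithLp.toLp 2 ![(x 0 + x 1) / Real.sqrt 2, (x 0 - x 1) / Real.sqrt 2, x 2, x 3]))) := by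
    ext i
    fin_cases i <;>
      (simp [swapReflection_apply, mirrorReflection_apply, Equiv.swap_apply_def, h0, h1, h2, h3]; try ring)
  rw [this, K_swapR hW, K_mirror hW, K_mirror hW]

/-- The swap in the diagonal frame is `x₁ ↦ -x₁` upstairs. -/
theorem kernel45_swap (x y : EuclideanSpace ℝ (Fin 4)) (h0 : y 0 = x 1) (h1 : y 1 = x 0)
    (h2 : y 2 = x 2) (h3 : y 3 = x 3) :
    K (WithLp.toLp 2 ![(y 0 + y 1) / Real.sqrt 2, (y 0 - y 1) / Real.sqrt 2, y 2, y 3]) =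
      K (WithLp.toLp 2 ![(x 0 + x 1) / Real.sqrt 2, (x 0 - x 1) / Real.sqrt 2, x 2, x 3]) := by
  have : (WithLp.toLp 2 ![(y 0 + y 1) / Real.sqrt 2, (y 0 - y 1) / Real.sqrt 2, y 2, y 3] :
      EuclideanSpace ℝ (Fin 4)) = mirrorReflection 1
        (WithLp.toLp 2 ![(x 0 + x 1) / Real.sqrt 2, (x 0 - x 1) / Real.sqrt 2, x 2, x 3]) := by
    ext i
    fin_cases i <;> (simp [mirrorReflection_apply, h0, h1, h2, h3]; try ring)
  rw [this, K_mirror hW]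

/-- `x₁ ↦ -x₁` in the diagonal frame is the swap upstairs. -/
theorem kernel45_neg1 (x y : EuclideanSpace ℝ (Fin 4)) (h0 : y 0 = x 0) (h1 : y 1 = -x 1)
    (h2 : y 2 = x 2) (h3 : y 3 = x 3) :
    K (WithLp.toLp 2 ![(y 0 + y 1) / Real.sqrt 2, (y 0 - y 1) / Real.sqrt 2, y 2, y 3]) =
      K (WithLp.toLp 2 ![(x 0 + x 1) / Real.sqrt 2, (x 0 - x 1) / Real.sqrt 2, x 2, x 3]) := by
  have : (WithLp.toLp 2 ![(y 0 + y 1) / Real.sqrt 2, (y 0 - y 1) / Real.sqrt 2, y 2, y 3] :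
      EuclideanSpace ℝ (Fin 4)) = swapReflection 0 1
        (WithLp.toLp 2 ![(x 0 + x 1) / Real.sqrt 2, (x 0 - x 1) / Real.sqrt 2, x 2, x 3]) := by
    ext i
    fin_cases i <;> (simp [swapReflection_apply, Equiv.swap_apply_def, h0, h1, h2, h3]; try ring)
  rw [this, K_swapR hW]

/-- **The crux's diagonal clause is the axis clause of `K ∘ L₄`.** With `Y_i = σ₁ (L₄ x_i)`
(`σ₁ = mirrorReflection 1`): `L₄ (θ x_i - x_j) = σ₁ (swap₀₁ Y_i - Y_j)` and `Y_i 1 < Y_i 0 ⟺ 0 < x_i 0`. -/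
theorem kernel45_axisRP
    (hdg : ∀ (m : ℕ) (x : Fin m → EuclideanSpace ℝ (Fin 4)) (c : Fin m → ℝ), (∀ i, x i 1 < x i 0) →
      0 ≤ ∑ i, ∑ j, c i * c j *
        K (LinearIsometryEquiv.piLpCongrLeft 2 ℝ ℝ (Equiv.swap (0 : Fin 4) 1) (x i) - x j)) :
    ∀ (m : ℕ) (x : Fin m → EuclideanSpace ℝ (Fin 4)) (c : Fin m → ℝ), (∀ i, 0 < x i 0) →
      0 ≤ ∑ i, ∑ j, c i * c j *
        K (WithLp.toLp 2 ![((timeReflection 4 (x i) - x j) 0 + (timeReflection 4 (x i) - x j) 1) /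
          Real.sqrt 2, ((timeReflection 4 (x i) - x j) 0 - (timeReflection 4 (x i) - x j) 1) /
          Real.sqrt 2, (timeReflection 4 (x i) - x j) 2, (timeReflection 4 (x i) - x j) 3]) := by
  intro m x c hx
  have hs : 0 < Real.sqrt 2 := Real.sqrt_pos.2 two_pos
  set Y : Fin m → EuclideanSpace ℝ (Fin 4) := fun i => mirrorReflection 1
    (WithLp.toLp 2 ![(x i 0 + x i 1) / Real.sqrt 2, (x i 0 - x i 1) / Real.sqrt 2, x i 2, x i 3])
    with hY
  have hY' : ∀ i, Y i 1 < Y i 0 := by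
    intro i
    simp only [hY, mirrorReflection_apply]
    simp only [Fin.isValue, ↓reduceIte, Matrix.cons_val_one, Matrix.cons_val_zero]
    have h1 : -((x i 0 - x i 1) / Real.sqrt 2) = (x i 1 - x i 0) / Real.sqrt 2 := by ring
    rw [h1]
    exact div_lt_div_of_pos_right (by linarith [hx i]) hs
  refine (hdg m Y c hY').trans_eq (Finset.sum_congr rfl fun i _ => Finset.sum_congr rfl fun j _ => ?_)
  congr 1
  have hvec : (WithLp.toLp 2 ![((timeReflection 4 (x i) - x j) 0 + (timeReflection 4 (x i) - x j) 1) /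
          Real.sqrt 2, ((timeReflection 4 (x i) - x j) 0 - (timeReflection 4 (x i) - x j) 1) /
          Real.sqrt 2, (timeReflection 4 (x i) - x j) 2, (timeReflection 4 (x i) - x j) 3] :
        EuclideanSpace ℝ (Fin 4)) =
      mirrorReflection 1 (LinearIsometryEquiv.piLpCongrLeft 2 ℝ ℝ (Equiv.swap (0 : Fin 4) 1) (Y i) - Y j) := by
    ext k
    fin_cases k <;>
      (simp [hY, mirrorReflection_apply, timeReflection_apply, LinearIsometryEquiv.piLpCongrLeft_apply,
        Equiv.piCongrLeft'_apply, Equiv.symm_swap, Equiv.swap_apply_def]; try ring)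
  rw [hvec, K_mirror hW]

end Kernel45

/-! ## Glue III — planar bookkeeping -/

/-- **Smearing commutes with the light-cone involutions**: `smear (K ∘ L₄) h (a,b) = smear K h (L(a,b))`. -/
theorem smear_lc4 (K : EuclideanSpace ℝ (Fin 4) → ℝ) (h : ℝ × ℝ → ℝ) (x : ℝ × ℝ) :
    (∫ y : ℝ × ℝ, ∫ y' : ℝ × ℝ, h y * h y' *
      (fun w : EuclideanSpace ℝ (Fin 4) =>
        K (WithLp.toLp 2 ![(w 0 + w 1) / Real.sqrt 2, (w 0 - w 1) / Real.sqrt 2, w 2, w 3]))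
        (WithLp.toLp 2 ![x.1, x.2, (y - y').1, (y - y').2])) =
    ∫ y : ℝ × ℝ, ∫ y' : ℝ × ℝ, h y * h y' *
      K (WithLp.toLp 2 ![((x.1 + x.2) / Real.sqrt 2, (x.1 - x.2) / Real.sqrt 2).1,
        ((x.1 + x.2) / Real.sqrt 2, (x.1 - x.2) / Real.sqrt 2).2, (y - y').1, (y - y').2]) := by
  simp

/-- Polar coordinates in `ℝ × ℝ` (planner's glue, kept). -/
theorem exists_polar (x : ℝ × ℝ) (hx : x ≠ 0) :
    0 < Real.sqrt (x.1 ^ 2 + x.2 ^ 2) ∧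
      ∃ φ : ℝ, x = (Real.sqrt (x.1 ^ 2 + x.2 ^ 2) * Real.cos φ, Real.sqrt (x.1 ^ 2 + x.2 ^ 2) * Real.sin φ) := by
  set z : ℂ := ⟨x.1, x.2⟩ with hz
  have hz0 : z ≠ 0 := by
    intro h
    apply hx
    have h1 : x.1 = 0 := by simpa [hz] using congrArg Complex.re h
    have h2 : x.2 = 0 := by simpa [hz] using congrArg Complex.im h
    exact Prod.ext h1 h2
  have hnorm : ‖z‖ = Real.sqrt (x.1 ^ 2 + x.2 ^ 2) := by
    rw [Complex.norm_def, Complex.normSq_apply]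
    simp [hz, sq]
  have hpos : 0 < ‖z‖ := norm_pos_iff.mpr hz0
  refine ⟨hnorm ▸ hpos, Complex.arg z, ?_⟩
  have hc := Complex.cos_arg hz0
  have hs := Complex.sin_arg z
  have hne : ‖z‖ ≠ 0 := hpos.ne'
  rw [← hnorm, hc, hs]
  refine Prod.ext ?_ ?_
  · simp only []
    field_simp
    simp [hz]
  · simp only []
    field_simp
    simp [hz]

/-! ## The composition -/

/-- **Shell rigidity** (the route decl `PencilRigidity.ShellRigidity`, BY NAME). Fix `K` with the
crux hypotheses for some `η > 0`; `stub_exponentReduction` trades the exponent for `η' = min η 7 ∈ (0, 8)`;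
`stub_axisLaplace` represents `K` and `K ∘ L₄` along the time axis (boundedness away from `x₀ = 0` from
the bound; the symmetries and the axis clause of `K ∘ L₄` from `W(B₄)` and the diagonal clause);
`stub_smearTransport` moves both to every transverse autocorrelation smearing `F_h` (order `8 - η' < 8`,
`D₄`, axis and diagonal representations, the latter through `smear_lc4`); `stub_planarRadial` makes
`F_h` radial; `stub_radialLift` lifts radial smears to invariance of `K` under every linear isometry. -/
theorem ShellRigidity_proof : Summit.QuantumFields.YangMills.Theses.PencilRigidity.ShellRigidity := by
  intro K hcont hbd hW hax hdg R x _hx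
  change ∀ R : EuclideanSpace ℝ (Fin 4) ≃ₗᵢ[ℝ] EuclideanSpace ℝ (Fin 4), IsSignedPermIsometry R →
    ∀ x : EuclideanSpace ℝ (Fin 4), K (R x) = K x at hW
  obtain ⟨C, η, hη, hb⟩ := hbd
  -- exponent `η' = min η 7 ∈ (0, 8)`
  obtain ⟨C', hb'⟩ := stub_exponentReduction K η hη hcont ⟨C, hb⟩ hW hax
  set η' := min η 7 with hη'def
  have hη' : 0 < η' := lt_min hη (by norm_num)
  have h8 : η' < 8 := lt_of_le_of_lt (min_le_right η 7) (by norm_num)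
  have hσ : 0 < 8 - η' := by linarith
  have hσ8 : 8 - η' < 8 := by linarith
  -- boundedness away from the time-zero hyperplane, for `K` and for `K ∘ L₄`
  have hbdd_of : ∀ K₁ : EuclideanSpace ℝ (Fin 4) → ℝ,
      (∀ x : EuclideanSpace ℝ (Fin 4), x ≠ 0 → |K₁ x| ≤ C' * (1 + ‖x‖ ^ (η' - 10))) →
      ∀ ε : ℝ, 0 < ε → ∃ B : ℝ, ∀ x : EuclideanSpace ℝ (Fin 4), ε ≤ |x 0| → |K₁ x| ≤ B := by
    intro K₁ hK₁ ε hε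
    refine ⟨|C'| * (1 + ε ^ (η' - 10)), fun x hx0 => ?_⟩
    have hxn : ε ≤ ‖x‖ :=
      hx0.trans ((Real.norm_eq_abs _).symm.le.trans (PiLp.norm_apply_le x 0))
    have hx : x ≠ 0 := by
      intro h0; rw [h0, norm_zero] at hxn; linarith
    have hq : ‖x‖ ^ (η' - 10) ≤ ε ^ (η' - 10) :=
      Real.rpow_le_rpow_of_nonpos hε hxn (by linarith)
    have h0 : (0 : ℝ) ≤ 1 + ‖x‖ ^ (η' - 10) := by positivity
    calc |K₁ x| ≤ C' * (1 + ‖x‖ ^ (η' - 10)) := hK₁ x hx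
      _ ≤ |C'| * (1 + ‖x‖ ^ (η' - 10)) := mul_le_mul_of_nonneg_right (le_abs_self C') h0
      _ ≤ |C'| * (1 + ε ^ (η' - 10)) := mul_le_mul_of_nonneg_left (by linarith) (abs_nonneg C')
  -- Laplace–Fourier representations along the time axis, in the axis frame and the diagonal frame
  have hrepK := stub_axisLaplace K hcont (hbdd_of K hb') (K_theta hW) (K_parity hW) hax
  have hrepK45 := stub_axisLaplace
    (fun x => K (WithLp.toLp 2 ![(x 0 + x 1) / Real.sqrt 2, (x 0 - x 1) / Real.sqrt 2, x 2, x 3]))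
    (kernel45_continuousOn hcont) (hbdd_of _ (kernel45_bound hb')) (kernel45_theta hW)
    (kernel45_parity hW) (kernel45_axisRP hW hdg)
  -- radiality of every smeared kernel, in equal-radius form
  have hsm : ∀ h : ℝ × ℝ → ℝ, Continuous h → HasCompactSupport h →
      ∀ x y : ℝ × ℝ, x ≠ 0 → x.1 ^ 2 + x.2 ^ 2 = y.1 ^ 2 + y.2 ^ 2 →
        (∫ w : ℝ × ℝ, ∫ w' : ℝ × ℝ,
            h w * h w' * K (WithLp.toLp 2 ![x.1, x.2, (w - w').1, (w - w').2])) =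
          ∫ w : ℝ × ℝ, ∫ w' : ℝ × ℝ,
            h w * h w' * K (WithLp.toLp 2 ![y.1, y.2, (w - w').1, (w - w').2]) := by
    intro h hhc hhs x y hx hxy
    set F : ℝ × ℝ → ℝ := fun x => ∫ w : ℝ × ℝ, ∫ w' : ℝ × ℝ,
      h w * h w' * K (WithLp.toLp 2 ![x.1, x.2, (w - w').1, (w - w').2]) with hFdef
    obtain ⟨hFc, hFb, hFsym, hFrep⟩ := stub_smearTransport K η' hη' h8 hcont ⟨C', hb'⟩ (K_swap hW)
      (K_neg1 hW) (K_theta hW) hrepK h hhc hhs F (fun _ => rfl)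
    obtain ⟨-, -, -, hF45rep⟩ := stub_smearTransport
      (fun x => K (WithLp.toLp 2 ![(x 0 + x 1) / Real.sqrt 2, (x 0 - x 1) / Real.sqrt 2, x 2, x 3]))
      η' hη' h8 (kernel45_continuousOn hcont) ⟨C', kernel45_bound hb'⟩ (kernel45_swap hW)
      (kernel45_neg1 hW) (kernel45_theta hW) hrepK45 h hhc hhs
      (fun x => F ((x.1 + x.2) / Real.sqrt 2, (x.1 - x.2) / Real.sqrt 2))
      (fun x => by rw [hFdef, smear_lc4])
    have hrad := stub_planarRadial F (8 - η') hσ hσ8 hFc hFb hFsym hFrep hF45rep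
    obtain ⟨hrx, φ, hφ⟩ := exists_polar x hx
    have hy : y ≠ 0 := by
      intro hy0
      rw [hy0] at hxy
      simp only [Prod.fst_zero, Prod.snd_zero] at hxy
      have : Real.sqrt (x.1 ^ 2 + x.2 ^ 2) = 0 := by rw [hxy]; simp
      linarith
    obtain ⟨hry, ψ, hψ⟩ := exists_polar y hy
    show F x = F y
    rw [hφ, hψ, hrad _ _ hrx, hrad _ _ hry, hxy]
  exact stub_radialLift K hcont hW hsm R x

end Summit.QuantumFields.YangMills.Cruxes.ShellRigidity.TransverseSmearingPlanarThreshold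

end
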